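import Summits.CriticalPhenomena.CardyFormulaZ2.Theses.CardyUSTContinuation
import Summits.CriticalPhenomena.CardyFormulaZ2.Theorems.CardyUSTContinuationUniformAnalyticExtensionStubRiemann
import Summits.CriticalPhenomena.CardyFormulaZ2.Theorems.CardyUSTContinuationUniformAnalyticExtensionStubMaxModulus
import Summits.CriticalPhenomena.CardyFormulaZ2.Theorems.CardyUSTContinuationUniformAnalyticExtensionStubRatioToCrux
import Literature.Probability.LatticeModels.FKTwoArcPartitionPolynomials
import HarnessLib

/-!
# Normal form of the crux `UniformAnalyticExtension` (stmt-CriticalPhenomena-6047, route `CardyUSTContinuation`)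

Supports file of the line `registered` (birth skeleton v4).  Write `S = [t₁, 1] ⊂ ℂ`,
`U_ρ = Metric.thickening ρ S`, `Z_δ = fkTwoArcPartitionPolynomials R δ .joint`,
`N_δ = fkTwoArcCrossingPolynomial R δ .joint` (both `ℕ[X]`; `u_R(t, δ) = N_δ(t)/Z_δ(t)` for `δ, t > 0`
by the Literature reduction `measureReal_fkDomainMeasure_discreteCrossing`), and consider the three
propositions (all quantified `∀ R, ∀ t₁ ∈ (0,1), ∃ ρ > 0 …, ∀ᶠ δ → 0⁺, …`):

* **ratio bound** `RB`: `∃ M`, `‖N_δ(z)/Z_δ(z)‖ ≤ M` on `U_ρ` (junk-valued complex quotient);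
* **zero cancellation** `ZC`: `N_δ/Z_δ` is bounded on a punctured neighbourhood of every point of
  `U_ρ` (every zero of `Z_δ` in `U_ρ` is cancelled by `N_δ`; the bound may depend on `δ` and the point);
* **annulus bound** `AB`: `∃ ρ₀ M`, for every `ρ ∈ (0, ρ₀]`, `‖N_δ/Z_δ‖ ≤ M` on the part of `U_ρ` at
  distance `> ρ/2` from `S`.

We prove `UniformAnalyticExtension ↔ RB` (⇐ is the landed stub `stub_ratioToCrux`, p145290; ⇒ is the
identity theorem: the analytic extension `g` of `u_R(·, δ)` satisfies `g · Z_δ = N_δ` on the convex set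
`U_ρ` because it does on the real segment) and `RB ↔ (ZC ∧ AB)` (⇐ regularises `N_δ/Z_δ` by Riemann's
theorem — landed engine `stub_riemann`, p145158 — pushes the annulus bound to the regularisation
through the punctured limits and spreads it over `U_ρ` by the maximum modulus principle — landed engine
`stub_maxModulus`, p145160).  Consequently the two open stubs `stub_zeroCancel` (= `ZC`) and
`stub_annulusBound` (= `AB`) of the registered skeleton are each a CONSEQUENCE of the crux and jointly
EQUIVALENT to it: refuting either refutes the crux; proving both proves it.  Mathlib + the three landed
stub modules only; every statement is inlined (no `def`). [folklore]
-/

noncomputable section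

open Filter Topology Set Polynomial Metric
open Literature.Probability.LatticeModels
open Literature.Probability.RandomPlanarGeometry (ConformalRectangle)

namespace Summit.CriticalPhenomena.CardyFormulaZ2.Cruxes.UniformAnalyticExtension.Birth

/-- The complex segment `[t₁, 1] ⊂ ℂ` is convex. [folklore] -/
theorem normalForm_convex_ofReal_image_Icc (t₁ : ℝ) :
    Convex ℝ (((↑) : ℝ → ℂ) '' Set.Icc t₁ 1) := by
  rintro _ ⟨a, ha, rfl⟩ _ ⟨b, hb, rfl⟩ u v hu hv huv
  refine ⟨u * a + v * b, ?_, by push_cast; simp⟩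
  have h := (convex_Icc t₁ 1) ha hb hu hv huv
  simpa [smul_eq_mul] using h

/-- **Crux ⇒ ratio bound** (identity theorem).  If `UniformAnalyticExtension` holds then, with the
same `ρ`, `M`, the junk-valued crossing ratio `N_δ/Z_δ` is bounded by `M` on `U_ρ` for all small `δ`:
the analytic extension `g` satisfies `g · Z_δ = N_δ` on the real segment (where `Z_δ > 0` and
`g = u_R(·, δ) = N_δ/Z_δ`), hence on the convex — so preconnected — open set `U_ρ`; off the roots of
`Z_δ` the quotient is `g`, at the roots it is `0`. [folklore] -/
theorem normalForm_ratioBound_of_crux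
    (h : Summit.CriticalPhenomena.CardyFormulaZ2.Theses.CardyUSTContinuation.UniformAnalyticExtension) :
    ∀ R : ConformalRectangle, ∀ t₁ ∈ Set.Ioo (0:ℝ) 1, ∃ ρ > (0:ℝ), ∃ M : ℝ, ∀ᶠ δ in 𝓝[>] (0:ℝ),
      ∀ z ∈ thickening ρ (((↑) : ℝ → ℂ) '' Set.Icc t₁ 1),
        ‖aeval z (fkTwoArcCrossingPolynomial R δ ArcWiring.joint) /
            aeval z (fkTwoArcPartitionPolynomials R δ ArcWiring.joint)‖ ≤ M := by
  intro R t₁ ht₁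
  obtain ⟨ρ, hρ, M, hev⟩ := h R t₁ ht₁
  refine ⟨ρ, hρ, M, ?_⟩
  filter_upwards [hev, self_mem_nhdsWithin] with δ hδg hδ
  obtain ⟨g, hg, hgM, hgu⟩ := hδg
  have hδ' : (0:ℝ) < δ := hδ
  set S : Set ℂ := ((↑) : ℝ → ℂ) '' Set.Icc t₁ 1 with hSdef
  set N := fkTwoArcCrossingPolynomial R δ ArcWiring.joint with hNdef
  set Z := fkTwoArcPartitionPolynomials R δ ArcWiring.joint with hZdef
  -- `g · Z = N` on the real segment
  have hreal : ∀ t ∈ Set.Icc t₁ 1, g t * aeval (t : ℂ) Z = aeval (t : ℂ) N := by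
    intro t ht
    have ht0 : 0 < t := ht₁.1.trans_le ht.1
    have hZt : aeval (t : ℂ) Z ≠ 0 := by
      rw [← ratioToCrux_ofReal_aeval_natPoly, Complex.ofReal_ne_zero]
      exact (ratioToCrux_aeval_partition_pos R hδ' ht0 _).ne'
    have hgt := hgu t ht
    simp only [dif_pos hδ'] at hgt
    rw [@measureReal_fkDomainMeasure_discreteCrossing R δ hδ' t ht0
        ((meshDomain_finite R.isBounded hδ').fintype),
      Complex.ofReal_div, ratioToCrux_ofReal_aeval_natPoly, ratioToCrux_ofReal_aeval_natPoly] at hgt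
    rw [hgt, div_mul_cancel₀ _ hZt]
  -- identity theorem on the (convex) thickening
  set t₀ : ℝ := (t₁ + 1) / 2 with ht₀def
  have ht₀ : t₀ ∈ Set.Icc t₁ 1 := ⟨by rw [ht₀def]; linarith [ht₁.2], by rw [ht₀def]; linarith [ht₁.2]⟩
  have ht₀S : (t₀ : ℂ) ∈ thickening ρ S := self_subset_thickening hρ S ⟨t₀, ht₀, rfl⟩
  have hA1 : AnalyticOnNhd ℂ (fun z => g z * aeval z Z) (thickening ρ S) :=
    (hg.mul (Polynomial.differentiable_aeval Z).differentiableOn).analyticOnNhd isOpen_thickening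
  have hA2 : AnalyticOnNhd ℂ (fun z => aeval z N) (thickening ρ S) :=
    (Polynomial.differentiable_aeval N).differentiableOn.analyticOnNhd isOpen_thickening
  have hfreq : ∃ᶠ z in 𝓝[≠] (t₀ : ℂ), g z * aeval z Z = aeval z N := by
    have hT : Tendsto ((↑) : ℝ → ℂ) (𝓝[≠] t₀) (𝓝[≠] (t₀ : ℂ)) := by
      refine tendsto_nhdsWithin_iff.2 ⟨Complex.continuous_ofReal.continuousAt.tendsto.mono_left
        nhdsWithin_le_nhds, ?_⟩
      filter_upwards [self_mem_nhdsWithin] with t ht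
      simpa using ht
    refine hT.frequently ?_
    have hIcc : ∀ᶠ t in 𝓝[≠] t₀, t ∈ Set.Icc t₁ 1 :=
      mem_nhdsWithin_of_mem_nhds (Icc_mem_nhds (by rw [ht₀def]; linarith [ht₁.2])
        (by rw [ht₀def]; linarith [ht₁.2]))
    exact (hIcc.mono fun t ht => hreal t ht).frequently
  have hEq : EqOn (fun z => g z * aeval z Z) (fun z => aeval z N) (thickening ρ S) :=
    hA1.eqOn_of_preconnected_of_frequently_eq hA2
      ((normalForm_convex_ofReal_image_Icc t₁).thickening ρ).isPreconnected ht₀S hfreq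
  -- back to the quotient
  intro w hw
  have hM0 : 0 ≤ M := (norm_nonneg _).trans (hgM w hw)
  by_cases hZw : aeval w Z = 0
  · rw [hZw, div_zero, norm_zero]
    exact hM0
  · have h' : g w * aeval w Z = aeval w N := hEq hw
    have : aeval w N / aeval w Z = g w := by
      rw [← h']
      exact mul_div_cancel_right₀ _ hZw
    rw [this]
    exact hgM w hw

/-- **Normal form of the crux**: `UniformAnalyticExtension` holds iff for every conformal rectangle
`R` and `t₁ ∈ (0,1)` there are `ρ > 0`, `M` such that for all small `δ > 0` the junk-valued complex
crossing ratio `N_δ(z)/Z_δ(z)` of the jointly-wired self-dual FK polynomials is bounded by `M` on the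
`ρ`-neighbourhood of `[t₁, 1] ⊂ ℂ` (⇒ `normalForm_ratioBound_of_crux`; ⇐ the landed stub
`stub_ratioToCrux`, whose conclusion is the body of the route decl). [folklore] -/
theorem normalForm_crux_iff_ratioBound :
    Summit.CriticalPhenomena.CardyFormulaZ2.Theses.CardyUSTContinuation.UniformAnalyticExtension ↔
      ∀ R : ConformalRectangle, ∀ t₁ ∈ Set.Ioo (0:ℝ) 1, ∃ ρ > (0:ℝ), ∃ M : ℝ, ∀ᶠ δ in 𝓝[>] (0:ℝ),
        ∀ z ∈ thickening ρ (((↑) : ℝ → ℂ) '' Set.Icc t₁ 1),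
          ‖aeval z (fkTwoArcCrossingPolynomial R δ ArcWiring.joint) /
              aeval z (fkTwoArcPartitionPolynomials R δ ArcWiring.joint)‖ ≤ M :=
  ⟨normalForm_ratioBound_of_crux, fun h => stub_ratioToCrux h⟩

/-- **Ratio bound ⇒ zero cancellation**: a uniform bound on `U_ρ` is in particular a bound on a
punctured neighbourhood of each of its points (`U_ρ` is open); this is the registered stub
`stub_zeroCancel` as a consequence of the normal form (hence of the crux). [folklore] -/
theorem normalForm_zeroCancel_of_ratioBound
    (h : ∀ R : ConformalRectangle, ∀ t₁ ∈ Set.Ioo (0:ℝ) 1, ∃ ρ > (0:ℝ), ∃ M : ℝ, ∀ᶠ δ in 𝓝[>] (0:ℝ),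
      ∀ z ∈ thickening ρ (((↑) : ℝ → ℂ) '' Set.Icc t₁ 1),
        ‖aeval z (fkTwoArcCrossingPolynomial R δ ArcWiring.joint) /
            aeval z (fkTwoArcPartitionPolynomials R δ ArcWiring.joint)‖ ≤ M) :
    ∀ R : ConformalRectangle, ∀ t₁ ∈ Set.Ioo (0:ℝ) 1, ∃ ρ > (0:ℝ), ∀ᶠ δ in 𝓝[>] (0:ℝ),
      ∀ z ∈ thickening ρ (((↑) : ℝ → ℂ) '' Set.Icc t₁ 1), ∃ C : ℝ, ∀ᶠ w in 𝓝[≠] z,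
        ‖aeval w (fkTwoArcCrossingPolynomial R δ ArcWiring.joint) /
            aeval w (fkTwoArcPartitionPolynomials R δ ArcWiring.joint)‖ ≤ C := by
  intro R t₁ ht₁
  obtain ⟨ρ, hρ, M, hev⟩ := h R t₁ ht₁
  refine ⟨ρ, hρ, ?_⟩
  filter_upwards [hev] with δ hδ
  intro z hz
  refine ⟨M, ?_⟩
  filter_upwards [mem_nhdsWithin_of_mem_nhds (isOpen_thickening.mem_nhds hz)] with w hw
  exact hδ w hw

/-- **Ratio bound ⇒ annulus bound**: with `ρ₀ := ρ` and the same `M`, the bound on `U_ρ₀` restricts to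
the outer half of every `U_ρ'`, `ρ' ≤ ρ₀` (`thickening` is monotone in the radius); this is the
registered stub `stub_annulusBound` as a consequence of the normal form (hence of the crux).
[folklore] -/
theorem normalForm_annulusBound_of_ratioBound
    (h : ∀ R : ConformalRectangle, ∀ t₁ ∈ Set.Ioo (0:ℝ) 1, ∃ ρ > (0:ℝ), ∃ M : ℝ, ∀ᶠ δ in 𝓝[>] (0:ℝ),
      ∀ z ∈ thickening ρ (((↑) : ℝ → ℂ) '' Set.Icc t₁ 1),
        ‖aeval z (fkTwoArcCrossingPolynomial R δ ArcWiring.joint) /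
            aeval z (fkTwoArcPartitionPolynomials R δ ArcWiring.joint)‖ ≤ M) :
    ∀ R : ConformalRectangle, ∀ t₁ ∈ Set.Ioo (0:ℝ) 1, ∃ ρ₀ > (0:ℝ), ∃ M : ℝ, ∀ ρ ∈ Set.Ioc (0:ℝ) ρ₀,
      ∀ᶠ δ in 𝓝[>] (0:ℝ), ∀ z ∈ thickening ρ (((↑) : ℝ → ℂ) '' Set.Icc t₁ 1),
        ρ / 2 < infDist z (((↑) : ℝ → ℂ) '' Set.Icc t₁ 1) →
        ‖aeval z (fkTwoArcCrossingPolynomial R δ ArcWiring.joint) /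
            aeval z (fkTwoArcPartitionPolynomials R δ ArcWiring.joint)‖ ≤ M := by
  intro R t₁ ht₁
  obtain ⟨ρ, hρ, M, hev⟩ := h R t₁ ht₁
  refine ⟨ρ, hρ, M, fun ρ' hρ' => ?_⟩
  filter_upwards [hev] with δ hδ
  intro z hz _
  exact hδ z (thickening_mono hρ'.2 _ hz)

/-- **Zero cancellation ∧ annulus bound ⇒ ratio bound** (the skeleton's glue `ratioBound_of` with
its two engine hypotheses discharged by the landed `stub_riemann` and `stub_maxModulus`): with
`ρ := min ρ_ZC ρ₀` and the annulus constant `M`, regularise the locally bounded quotient `N_δ/Z_δ` on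
`U_ρ` (Riemann; it is differentiable off the finitely many roots of `Z_δ ≠ 0`), pass the annulus
bound to the regularisation `g` through the punctured limits, spread it over `U_ρ` by the maximum
modulus principle, and return to the quotient (`= g` off the roots of `Z_δ` by continuity, `= 0` at
them). [folklore] -/
theorem normalForm_ratioBound_of_zeroCancel_of_annulusBound
    (hZC : ∀ R : ConformalRectangle, ∀ t₁ ∈ Set.Ioo (0:ℝ) 1, ∃ ρ > (0:ℝ), ∀ᶠ δ in 𝓝[>] (0:ℝ),
      ∀ z ∈ thickening ρ (((↑) : ℝ → ℂ) '' Set.Icc t₁ 1), ∃ C : ℝ, ∀ᶠ w in 𝓝[≠] z,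
        ‖aeval w (fkTwoArcCrossingPolynomial R δ ArcWiring.joint) /
            aeval w (fkTwoArcPartitionPolynomials R δ ArcWiring.joint)‖ ≤ C)
    (hAB : ∀ R : ConformalRectangle, ∀ t₁ ∈ Set.Ioo (0:ℝ) 1, ∃ ρ₀ > (0:ℝ), ∃ M : ℝ,
      ∀ ρ ∈ Set.Ioc (0:ℝ) ρ₀, ∀ᶠ δ in 𝓝[>] (0:ℝ), ∀ z ∈ thickening ρ (((↑) : ℝ → ℂ) '' Set.Icc t₁ 1),
        ρ / 2 < infDist z (((↑) : ℝ → ℂ) '' Set.Icc t₁ 1) →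
        ‖aeval z (fkTwoArcCrossingPolynomial R δ ArcWiring.joint) /
            aeval z (fkTwoArcPartitionPolynomials R δ ArcWiring.joint)‖ ≤ M) :
    ∀ R : ConformalRectangle, ∀ t₁ ∈ Set.Ioo (0:ℝ) 1, ∃ ρ > (0:ℝ), ∃ M : ℝ, ∀ᶠ δ in 𝓝[>] (0:ℝ),
      ∀ z ∈ thickening ρ (((↑) : ℝ → ℂ) '' Set.Icc t₁ 1),
        ‖aeval z (fkTwoArcCrossingPolynomial R δ ArcWiring.joint) /
            aeval z (fkTwoArcPartitionPolynomials R δ ArcWiring.joint)‖ ≤ M := by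
  intro R t₁ ht₁
  obtain ⟨ρ₁, hρ₁, h₁⟩ := hZC R t₁ ht₁
  obtain ⟨ρ₀, hρ₀, M, h₂⟩ := hAB R t₁ ht₁
  set ρ := min ρ₁ ρ₀ with hρdef
  have hρ : 0 < ρ := lt_min hρ₁ hρ₀
  have h₂' := h₂ ρ ⟨hρ, min_le_right _ _⟩
  refine ⟨ρ, hρ, M, ?_⟩
  filter_upwards [h₁, h₂', self_mem_nhdsWithin] with δ h₁δ h₂δ hδ
  have hδ' : (0:ℝ) < δ := hδ
  set S : Set ℂ := ((↑) : ℝ → ℂ) '' Set.Icc t₁ 1 with hSdef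
  set N := fkTwoArcCrossingPolynomial R δ ArcWiring.joint with hNdef
  set Z := fkTwoArcPartitionPolynomials R δ ArcWiring.joint with hZdef
  set f : ℂ → ℂ := fun w => aeval w N / aeval w Z with hfdef
  have hZ0 : Z ≠ 0 := fkTwoArcPartitionPolynomials_ne_zero R hδ' _
  have hSU : thickening ρ S ⊆ thickening ρ₁ S := thickening_mono (min_le_left _ _) _
  -- differentiability of `f` off the (finitely many) roots of `Z`
  have hd : ∀ z ∈ thickening ρ S, ∀ᶠ w in 𝓝[≠] z, DifferentiableAt ℂ f w := by
    intro z _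
    filter_upwards [ratioToCrux_eventually_aeval_ne_zero Z hZ0 z] with w hw
    exact ((Polynomial.differentiable_aeval N) w).div ((Polynomial.differentiable_aeval Z) w) hw
  have hb : ∀ z ∈ thickening ρ S, ∃ C : ℝ, ∀ᶠ w in 𝓝[≠] z, ‖f w‖ ≤ C :=
    fun z hz => h₁δ z (hSU hz)
  obtain ⟨g, hg, hT⟩ := stub_riemann (thickening ρ S) f isOpen_thickening hd hb
  -- the annulus bound passes to `g` through the limits
  have hgA : ∀ z ∈ thickening ρ S, ρ / 2 < infDist z S → ‖g z‖ ≤ M := by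
    intro z hz hzd
    have hopen : IsOpen {w : ℂ | w ∈ thickening ρ S ∧ ρ / 2 < infDist w S} :=
      isOpen_thickening.and (isOpen_lt continuous_const (continuous_infDist_pt S))
    have hev : ∀ᶠ w in 𝓝[≠] z, ‖f w‖ ≤ M := by
      have hmem : {w : ℂ | w ∈ thickening ρ S ∧ ρ / 2 < infDist w S} ∈ 𝓝[≠] z :=
        mem_nhdsWithin_of_mem_nhds (hopen.mem_nhds ⟨hz, hzd⟩)
      filter_upwards [hmem] with w hw
      exact h₂δ w hw.1 hw.2
    exact le_of_tendsto ((hT z hz).norm) hev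
  have hgU : ∀ z ∈ thickening ρ S, ‖g z‖ ≤ M :=
    stub_maxModulus S ρ M g ((isCompact_Icc.image Complex.continuous_ofReal).isBounded) hρ hg hgA
  -- back to the junk-valued quotient
  intro w hw
  change ‖f w‖ ≤ M
  by_cases hZw : aeval w Z = 0
  · have : f w = 0 := by simp only [hfdef, hZw, div_zero]
    rw [this, norm_zero]
    exact (norm_nonneg _).trans (hgU w hw)
  · have hfc : ContinuousAt f w :=
      ((Polynomial.differentiable_aeval N) _).continuousAt.div
        ((Polynomial.differentiable_aeval Z) _).continuousAt hZw
    have hgw : g w = f w :=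
      tendsto_nhds_unique (hT _ hw) (hfc.tendsto.mono_left nhdsWithin_le_nhds)
    rw [← hgw]
    exact hgU w hw

/-- **The two open stubs are jointly equivalent to the crux**: `UniformAnalyticExtension` holds iff
both the zero-cancellation statement (`stub_zeroCancel`) and the annulus bound (`stub_annulusBound`)
of the registered skeleton hold. [folklore] -/
theorem normalForm_crux_iff_zeroCancel_and_annulusBound :
    Summit.CriticalPhenomena.CardyFormulaZ2.Theses.CardyUSTContinuation.UniformAnalyticExtension ↔
      ((∀ R : ConformalRectangle, ∀ t₁ ∈ Set.Ioo (0:ℝ) 1, ∃ ρ > (0:ℝ), ∀ᶠ δ in 𝓝[>] (0:ℝ),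
          ∀ z ∈ thickening ρ (((↑) : ℝ → ℂ) '' Set.Icc t₁ 1), ∃ C : ℝ, ∀ᶠ w in 𝓝[≠] z,
            ‖aeval w (fkTwoArcCrossingPolynomial R δ ArcWiring.joint) /
                aeval w (fkTwoArcPartitionPolynomials R δ ArcWiring.joint)‖ ≤ C) ∧
        (∀ R : ConformalRectangle, ∀ t₁ ∈ Set.Ioo (0:ℝ) 1, ∃ ρ₀ > (0:ℝ), ∃ M : ℝ,
          ∀ ρ ∈ Set.Ioc (0:ℝ) ρ₀, ∀ᶠ δ in 𝓝[>] (0:ℝ),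
            ∀ z ∈ thickening ρ (((↑) : ℝ → ℂ) '' Set.Icc t₁ 1),
              ρ / 2 < infDist z (((↑) : ℝ → ℂ) '' Set.Icc t₁ 1) →
              ‖aeval z (fkTwoArcCrossingPolynomial R δ ArcWiring.joint) /
                  aeval z (fkTwoArcPartitionPolynomials R δ ArcWiring.joint)‖ ≤ M)) := by
  rw [normalForm_crux_iff_ratioBound]
  exact ⟨fun h => ⟨normalForm_zeroCancel_of_ratioBound h, normalForm_annulusBound_of_ratioBound h⟩,
    fun h => normalForm_ratioBound_of_zeroCancel_of_annulusBound h.1 h.2⟩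

end Summit.CriticalPhenomena.CardyFormulaZ2.Cruxes.UniformAnalyticExtension.Birth
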